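import Literature.Analysis.FunctionSpaces.LorentzGas
import HarnessLib

/-!
# Determinism of Lorentz-gas trajectories
(trunk T-KINETIC; topic Analysis/FunctionSpaces, next to `LorentzGas` and `LorentzGasProofs`;
serves the core fact `Literature.MathematicalPhysics.KineticTheory.gallavotti_lorentz_tendsto_dual` of the Boltzmann–Grad limit
of the Lorentz gas, `Literature.MathematicalPhysics.KineticTheory.LorentzGasGallavotti`)

A Lorentz-gas trajectory (`Kinetic.IsLorentzTrajectory ε c γ`: free flight between locally
finitely many non-grazing specular reflections at the balls of radius `ε` centred at the points
of `c`) is determined, forward in time, by its initial state: two trajectories in the same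
scatterer configuration with `γ₁ 0 = γ₂ 0` coincide for all `t ≥ 0`
(`Kinetic.IsLorentzTrajectory.eq_of_eq_zero`). Consequently the orbits of the a.e.-defined
hypothesis structure `Kinetic.LorentzFlow` are, on its good set, *the* billiard orbits, which is
what the computation of the annealed expectations in Gallavotti's proof uses (Gallavotti 1972;
Spohn, Comm. Math. Phys. 60 (1978) §1; Boldrighini–Bunimovich–Sinai 1983 §1).

## Proof

Real induction on the first disagreement time `T = inf {t ≥ 0 | γ₁ t ≠ γ₂ t}`: the two
trajectories agree on `[0, T)`, hence at `T` (positions are continuous; the outgoing velocity at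
`T` is either the free-flight velocity from slightly earlier, or the specular reflection of the
common left limit at the common obstacle), hence on a right neighbourhood of `T` (no reflection
times of either trajectory in some `(T, T + δ]`, by local finiteness, so both fly freely from the
common state at `T`) — contradicting the definition of `T`.

## References

* H. Spohn, *The Lorentz process converges to a random flight process*, Comm. Math. Phys. 60
  (1978) 277–290, §1.
* C. Boldrighini, L. A. Bunimovich, Ya. G. Sinai, *On the Boltzmann equation for the Lorentz
  gas*, J. Stat. Phys. 32 (1983) 477–501, §1.
-/

open MeasureTheory Metric Real Set Filter Topology
open scoped InnerProductSpace

namespace Literature.Analysis.FunctionSpaces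

noncomputable section

namespace IsLorentzTrajectory

variable {d : Type*} [Fintype d] {ε : ℝ} {c : PointConfig (EuclideanSpace ℝ d)}
  {γ γ₁ γ₂ : ℝ → EuclideanSpace ℝ d × EuclideanSpace ℝ d}

/-- **No reflection just after any time**: for every `T` there is `δ > 0` such that the
trajectory has no reflection time in `(T, T + δ]` (local finiteness). [folklore] -/
theorem exists_Ioc_notMem_collisionTimes (h : IsLorentzTrajectory ε c γ) (T : ℝ) :
    ∃ δ > 0, ∀ τ ∈ Ioc T (T + δ), τ ∉ lorentzCollisionTimes ε c γ := by
  set C := lorentzCollisionTimes ε c γ ∩ Ioc T (T + 1) with hC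
  have hfin : C.Finite :=
    (h.locFinite T (T + 1)).subset (inter_subset_inter_right _ Ioc_subset_Icc_self)
  rcases C.eq_empty_or_nonempty with hCe | hCne
  · refine ⟨1, one_pos, fun τ hτ hτC => ?_⟩
    have : τ ∈ C := ⟨hτC, hτ⟩
    rw [hCe] at this
    exact this
  · obtain ⟨τ₀, hτ₀C, hmin⟩ := Set.exists_min_image C id hfin hCne
    have hTτ₀ : T < τ₀ := hτ₀C.2.1
    refine ⟨(τ₀ - T) / 2, by linarith, fun τ hτ hτC => ?_⟩
    have hτ1 : τ ≤ T + 1 := by linarith [hτ.2, hτ₀C.2.2]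
    have := hmin τ ⟨hτC, hτ.1, hτ1⟩
    simp only [id_eq] at this
    linarith [hτ.2]

/-- **No reflection just before any time**: for every `T` there is `s < T` such that the
trajectory has no reflection time in `(s, T)` (local finiteness). [folklore] -/
theorem exists_Ioo_notMem_collisionTimes (h : IsLorentzTrajectory ε c γ) (T : ℝ) :
    ∃ s < T, ∀ τ ∈ Ioo s T, τ ∉ lorentzCollisionTimes ε c γ := by
  set C := lorentzCollisionTimes ε c γ ∩ Ico (T - 1) T with hC
  have hfin : C.Finite :=
    (h.locFinite (T - 1) T).subset (inter_subset_inter_right _ Ico_subset_Icc_self)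
  rcases C.eq_empty_or_nonempty with hCe | hCne
  · refine ⟨T - 1, by linarith, fun τ hτ hτC => ?_⟩
    have : τ ∈ C := ⟨hτC, hτ.1.le, hτ.2⟩
    rw [hCe] at this
    exact this
  · obtain ⟨τ₀, hτ₀C, hmax⟩ := Set.exists_max_image C id hfin hCne
    have hτ₀T : τ₀ < T := hτ₀C.2.2
    refine ⟨τ₀, hτ₀T, fun τ hτ hτC => ?_⟩
    have hτ1 : T - 1 ≤ τ := by linarith [hτ.1, hτ₀C.2.1]
    have := hmax τ ⟨hτC, hτ1, hτ.2⟩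
    simp only [id_eq] at this
    linarith [hτ.1]

/-- Free flight from `T` on an interval `(T, T + δ]` without reflection times: the state at
`t ∈ [T, T + δ]` is `(x(T) + (t - T) v(T), v(T))`. [folklore] -/
theorem eq_freeFlight_of_notMem (h : IsLorentzTrajectory ε c γ) {T δ : ℝ}
    (hfree : ∀ τ ∈ Ioc T (T + δ), τ ∉ lorentzCollisionTimes ε c γ) {t : ℝ} (ht : t ∈ Icc T (T + δ)) :
    γ t = ((γ T).1 + (t - T) • (γ T).2, (γ T).2) :=
  h.free T t ht.1 fun τ hτ => hfree τ ⟨hτ.1, hτ.2.trans ht.2⟩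

/-- **Determinism of Lorentz trajectories (forward uniqueness).** Two Lorentz-gas trajectories in
the same scatterer configuration with the same state at time `0` coincide at all times `t ≥ 0`
(the dynamics — free flight, and specular reflection of the incoming velocity at the unique
touched obstacle — has no branching; Spohn CMP 60 (1978) §1; Boldrighini–Bunimovich–Sinai 1983
§1). No hypothesis on `ε` is needed. [folklore] -/
theorem eq_of_eq_zero (h₁ : IsLorentzTrajectory ε c γ₁) (h₂ : IsLorentzTrajectory ε c γ₂)
    (h0 : γ₁ 0 = γ₂ 0) {t : ℝ} (ht : 0 ≤ t) : γ₁ t = γ₂ t := by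
  by_contra hne
  -- the set of disagreement times and its infimum
  set D : Set ℝ := {s | 0 ≤ s ∧ γ₁ s ≠ γ₂ s} with hD
  have hDne : D.Nonempty := ⟨t, ht, hne⟩
  have hDbdd : BddBelow D := ⟨0, fun s hs => hs.1⟩
  set T := sInf D with hT
  have hT0 : 0 ≤ T := le_csInf hDne fun s hs => hs.1
  -- agreement strictly before `T`
  have hagree : ∀ s, 0 ≤ s → s < T → γ₁ s = γ₂ s := fun s hs hsT => by
    by_contra hs'
    exact (csInf_le hDbdd ⟨hs, hs'⟩).not_gt hsT
  -- Step 1: agreement at `T`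
  have hTeq : γ₁ T = γ₂ T := by
    rcases hT0.eq_or_lt with hT0' | hTpos
    · rw [← hT0']; exact h0
    -- positions agree at `T` by continuity from the left
    have hev : ∀ᶠ s in 𝓝[<] T, γ₁ s = γ₂ s := by
      filter_upwards [Ioo_mem_nhdsLT hTpos] with s hs using hagree s hs.1.le hs.2
    have hx : (γ₁ T).1 = (γ₂ T).1 := by
      have l₁ : Tendsto (fun s => (γ₁ s).1) (𝓝[<] T) (𝓝 (γ₁ T).1) :=
        (h₁.pos_continuous.tendsto T).mono_left nhdsWithin_le_nhds
      have l₂ : Tendsto (fun s => (γ₂ s).1) (𝓝[<] T) (𝓝 (γ₂ T).1) :=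
        (h₂.pos_continuous.tendsto T).mono_left nhdsWithin_le_nhds
      have l₁' : Tendsto (fun s => (γ₂ s).1) (𝓝[<] T) (𝓝 (γ₁ T).1) :=
        l₁.congr' (hev.mono fun s hs => by rw [hs])
      exact tendsto_nhds_unique l₁' l₂
    -- a reflection-free interval `(s₀, T)` for both trajectories
    obtain ⟨s₁, hs₁T, hfree₁⟩ := h₁.exists_Ioo_notMem_collisionTimes T
    obtain ⟨s₂, hs₂T, hfree₂⟩ := h₂.exists_Ioo_notMem_collisionTimes T
    by_cases hcol : T ∈ lorentzCollisionTimes ε c γ₁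
    · -- reflection at `T` for both, from the same incoming velocity at the same obstacle
      obtain ⟨a, ha, hTa⟩ := hcol
      have hTa₂ : ‖(γ₂ T).1 - a‖ = ε := by rw [← hx]; exact hTa
      obtain ⟨-, vl₁, hvl₁, -, hout₁⟩ := h₁.reflect T a ha hTa
      obtain ⟨-, vl₂, hvl₂, -, hout₂⟩ := h₂.reflect T a ha hTa₂
      have hvl : vl₁ = vl₂ := by
        have : Tendsto (fun s => (γ₂ s).2) (𝓝[<] T) (𝓝 vl₁) :=
          hvl₁.congr' (hev.mono fun s hs => by rw [hs])
        exact tendsto_nhds_unique this hvl₂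
      exact Prod.ext hx (by rw [hout₁, hout₂, hx, hvl])
    · -- no reflection at `T`: free flight from a common earlier state
      have hcol₂ : T ∉ lorentzCollisionTimes ε c γ₂ := by
        rintro ⟨a, ha, hTa⟩
        exact hcol ⟨a, ha, by rw [hx]; exact hTa⟩
      set s := max (max s₁ s₂) 0 with hs
      have hsT : s < T := max_lt (max_lt hs₁T hs₂T) hTpos
      have hs0 : 0 ≤ s := le_max_right _ _
      -- pick a point `u ∈ (s, T)`; both fly freely on `(u, T]`
      set u := (s + T) / 2 with hu
      have hsu : s < u := by rw [hu]; linarith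
      have huT : u < T := by rw [hu]; linarith
      have hF₁ : ∀ τ ∈ Ioc u T, τ ∉ lorentzCollisionTimes ε c γ₁ := fun τ hτ => by
        rcases hτ.2.eq_or_lt with rfl | hτT
        · exact hcol
        · exact hfree₁ τ ⟨(le_max_left _ _ |>.trans (le_max_left _ _) |>.trans_lt
            (hsu.trans hτ.1)), hτT⟩
      have hF₂ : ∀ τ ∈ Ioc u T, τ ∉ lorentzCollisionTimes ε c γ₂ := fun τ hτ => by
        rcases hτ.2.eq_or_lt with rfl | hτT
        · exact hcol₂
        · exact hfree₂ τ ⟨(le_max_right _ _ |>.trans (le_max_left _ _) |>.trans_lt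
            (hsu.trans hτ.1)), hτT⟩
      have e₁ := h₁.free u T huT.le hF₁
      have e₂ := h₂.free u T huT.le hF₂
      have hγu : γ₁ u = γ₂ u := hagree u (hs0.trans hsu.le) huT
      rw [e₁, e₂, hγu]
  -- Step 2: agreement on a right neighbourhood of `T`
  obtain ⟨δ₁, hδ₁, hfr₁⟩ := h₁.exists_Ioc_notMem_collisionTimes T
  obtain ⟨δ₂, hδ₂, hfr₂⟩ := h₂.exists_Ioc_notMem_collisionTimes T
  set δ := min δ₁ δ₂ with hδ
  have hδ0 : 0 < δ := lt_min hδ₁ hδ₂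
  have hagree' : ∀ s ∈ Icc T (T + δ), γ₁ s = γ₂ s := fun s hs => by
    have e₁ := h₁.eq_freeFlight_of_notMem (δ := δ) (fun τ hτ => hfr₁ τ ⟨hτ.1, hτ.2.trans
      (by linarith [min_le_left δ₁ δ₂])⟩) hs
    have e₂ := h₂.eq_freeFlight_of_notMem (δ := δ) (fun τ hτ => hfr₂ τ ⟨hτ.1, hτ.2.trans
      (by linarith [min_le_right δ₁ δ₂])⟩) hs
    rw [e₁, e₂, hTeq]
  -- contradiction with `T = inf D`
  have hlb : ∀ s ∈ D, T + δ ≤ s := fun s hs => by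
    by_contra hlt
    rw [not_le] at hlt
    rcases lt_or_ge s T with hsT | hTs
    · exact hs.2 (hagree s hs.1 hsT)
    · exact hs.2 (hagree' s ⟨hTs, hlt.le⟩)
  have : T + δ ≤ T := le_csInf hDne hlb
  linarith

/-- Determinism, two-sided form at nonnegative times: trajectories through the same state at time
`0` agree on `[0, ∞)` as functions restricted there. [folklore] -/
theorem eqOn_Ici_of_eq_zero (h₁ : IsLorentzTrajectory ε c γ₁) (h₂ : IsLorentzTrajectory ε c γ₂)
    (h0 : γ₁ 0 = γ₂ 0) : EqOn γ₁ γ₂ (Ici 0) := fun _ ht => h₁.eq_of_eq_zero h₂ h0 ht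

end IsLorentzTrajectory

namespace LorentzFlow

variable {d : Type*} [Fintype d] {ε : ℝ} {P : Measure (PointConfig (EuclideanSpace ℝ d))}

/-- **The Lorentz flow is the billiard orbit on its good set**: if `(c, z)` is good for the
a.e. hypothesis structure `Φ : Kinetic.LorentzFlow ε P` and `γ` is any Lorentz trajectory in the
configuration `c` with `γ 0 = z`, then `Φ.flow c t z = γ t` for all `t ≥ 0`. [folklore] -/
theorem flow_eq_of_isLorentzTrajectory (Φ : LorentzFlow ε P)
    {p : PointConfig (EuclideanSpace ℝ d) × (EuclideanSpace ℝ d × EuclideanSpace ℝ d)}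
    (hp : p ∈ Φ.good) {γ : ℝ → EuclideanSpace ℝ d × EuclideanSpace ℝ d}
    (hγ : IsLorentzTrajectory ε p.1 γ) (h0 : γ 0 = p.2) {t : ℝ} (ht : 0 ≤ t) :
    Φ.flow p.1 t p.2 = γ t :=
  (Φ.isTrajectory p hp).eq_of_eq_zero hγ (by rw [Φ.flow_zero p hp, h0]) ht

end LorentzFlow

end

end Literature.Analysis.FunctionSpaces
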